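import Literature.NumberTheory.EllipticCurves.MordellCurveThreeDescentLocal
import Literature.NumberTheory.EllipticCurves.MordellCurvePhiDescentHom
import Literature.NumberTheory.EllipticCurves.ShaIsogeny
import Literature.NumberTheory.EllipticCurves.SelmerCorankProofs
import Literature.NumberTheory.GaloisRepresentations.GaloisCohomologyKummerProofs
import HarnessLib

/-!
# The image of `a ↦ [C_a]` is the kernel of `φ_*` on `H¹(K, E_D)`; descent values have trivial class
# (the `μ₃`-descent on the Mordell curves `y² = x³ − 3c²`: Silverman, *AEC*, Thm. X.4.2(a) at `H¹(K, E)`)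

Topic `NumberTheory/EllipticCurves`. Sequel of `MordellCurveThreeDescent` (the torsor classes
`[C_a] = MordellDescent.torsorClass hc hD ha ∈ H¹(K, E_D)`, `D = −3c²`, `a ∈ K*`, Cassels 1964 p. 65),
`MordellCurveThreeDescentKernel` (`[C_a] = 0 ⇒ a ∈ δ(E'(K)) K*³`) and `MordellCurveThreeDescentLocal`
(`a ∈ δ(E'(E)) E*³ ⇒ [C_a]` dies in `H¹(E, E_D)` for every `K`-field `E`). Everything here is proved;
no definitions and no named facts. Three statements, all over an arbitrary field `K` of
characteristic `0`:

* §1 `WeierstrassCurve.localRestrictionKer_self_eq_bot` — for ANY Weierstrass curve `W/K`, the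
  "local" restriction `H¹(K, W) → H¹(K, W(K̄_K))` at the `K`-field `E := K` itself is injective: its
  kernel `W.localRestrictionKer K` is `⊥` (the compatible pair is, up to the choice of embedding —
  immaterial by `localRestrictionKerOfEmb_eq_holds` — the identity pair `(Γ_K, W(K̄)) → (Γ_K, W(K̄))`).
* §2 `MordellDescent.torsorClass_eq_zero_of_phiDescent` — **the converse of the kernel theorem**:
  if `a ∈ δ(E'(K)) · K*³` (`δ = phiDescent c` on `E' = E_{81c²}`) then `[C_a] = 0` — the composite
  `E'(K) → H¹(K, E_D[φ]) → H¹(K, E_D)` vanishes (Silverman X.4.2(a), exactness at `H¹(G, E[φ])`, easy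
  half). Proof: the tree's local theorem `torsorClass_mem_localRestrictionKer` at `E := K` and §1.
  Multiplicative-class form: `torsorClassQuotHom_cubeClass_phiDescent`.
* §3 **The image theorem** `MordellDescent.exists_torsorClass_eq_of_galH1Map_eq_zero`: for any
  `Γ_K`-equivariant homomorphism `f : E_D(K̄) → W'(K̄)` which is ONTO and whose kernel is contained
  in `E_D[φ] = {O, ±T}` (e.g. the `3`-isogeny `φ` itself, or — over `K ∋ √−3` — the endomorphism
  `[√−3]` of `E_D ≅ E'`), every class of `H¹(K, E_D)` killed by `f_*` is a torsor class `[C_a]`: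
  `ker f_* ⊆ im [C_·]` (Silverman X.4.2(a): `H¹(G, E[φ]) ↠ WC(E/K)[φ]`, with `H¹(K, μ₃) = K*/K*³`
  made explicit). Proof (cubic analogue of the tree's `TwoIsogenyTorsorImage`): for `c = [g]` with
  `f ∘ g = ∂Q`, `Q = f(P)`, the cocycle `g − ∂P` takes values `n(σ) T`, `n(στ) = n(σ) + ε(σ) n(τ)`
  (`ε` the mod-`3` cyclotomic sign); the `μ₃`-valued cocycle `σ ↦ ω^{n(σ)}` is `σ ↦ σβ/β` by
  Hilbert 90 for locally constant cocycles
  (`absoluteGaloisGroup.exists_eq_smul_div_of_isLocallyConstant_cocycle`), `β³ = a ∈ K` by Galois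
  descent, `∛a = ω^j β`, and `kummerExp a = n + (ε − 1) j` differs from `n` by the coboundary of
  `jT`. Conversely `f_* [C_a] = 0` as soon as `f(T) = O` (`galH1Map_torsorClass_eq_zero`).

These are the two facts about the torsor map that turn a SHARP `φ`-descent (local conditions met
only by descent values of rational points) into the vanishing of `Ш(E_D/K)[φ] = Ш ∩ ker φ_*`.

## References

* [SilvermanAEC2009] J. H. Silverman, *The Arithmetic of Elliptic Curves*, 2nd ed., GTM 106 (2009),
  Thm. X.4.2(a) (the Kummer sequence of an isogeny), Prop. X.4.9, Exercise 10.9.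
* [Cassels1964ArithmeticVI] J. W. S. Cassels, *Arithmetic on curves of genus 1. VI*, J. reine angew.
  Math. 214/215 (1964) 65–70, p. 65 ("the kernel consisting of precisely those `m` for which (2) has
  a rational point").
* [Serre1979] J.-P. Serre, *Local Fields*, Ch. X §1 (Hilbert 90); *Galois Cohomology*, I.§2.4, II.§1.
* Template in the tree: `Literature.NumberTheory.EllipticCurves.TwoIsogenyTorsorImage`
  (`exists_twoIsogenyTorsorClass_eq_of_galH1Map_eq_zero`).

## Design

Theorems only; conventions of the Mordell descent files (`K : Type u`, `[CharZero K]`,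
`open scoped Classical`, hypotheses `hc : c ≠ 0`, `hD : D = -3 * c ^ 2`). The image theorem is
stated for an abstract equivariant surjection with small kernel so that it serves both `φ` and
`[√−3]` without a comparison of the two maps on `K̄`-points.
-/

noncomputable section

open scoped Classical

universe u

/-! ## §1 Restriction from `K` to `K` is injective on `H¹` -/

namespace WeierstrassCurve

open Literature.NumberTheory.EllipticCurves Literature.NumberTheory.GaloisRepresentations

variable {K : Type u} [Field K] (W : WeierstrassCurve K)

/-- For the identity embedding `K̄ → K̄`, the attached restriction `Γ_K → Γ_K` is the identity.
[folklore] -/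
private theorem resGalOfEmb_id_apply (σ : Field.absoluteGaloisGroup K) :
    resGalOfEmb (K := K) (E := K) (AlgHom.id K (AlgebraicClosure K)) σ = σ := by
  rw [resGalOfEmb_apply]
  change (show AlgebraicClosure K ≃ₐ[K] AlgebraicClosure K from
      resGalAuxOfEmb (K := K) (E := K) (AlgHom.id K (AlgebraicClosure K)) σ) =
    (show AlgebraicClosure K ≃ₐ[K] AlgebraicClosure K from σ)
  apply AlgEquiv.ext
  intro x
  have h := apply_resGalAuxOfEmb_apply (K := K) (E := K) (AlgHom.id K (AlgebraicClosure K)) σ x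
  rw [AlgHom.id_apply, AlgHom.id_apply] at h
  exact h

/-- For the identity embedding, the attached map on points `W(K̄) → W(K̄_K) = W(K̄)` is the identity.
[folklore] -/
private theorem pointsMapOfEmb_id_apply (P : W.geomPoints) :
    pointsMapOfEmb W (E := K) (AlgHom.id K (AlgebraicClosure K)) P = P := by
  change Affine.Point.map _ P = P
  cases P <;> rfl

/-- The two `Γ_K`-actions on `W(K̄)` — as geometric points, and as "local points at the `K`-field
`K`" (through `restrictScalarsHom`) — agree. [folklore] -/
private theorem smul_localPoints_self (σ : Field.absoluteGaloisGroup K) (P : localPoints W K) :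
    σ • P = (show Field.absoluteGaloisGroup K from σ) • (show W.geomPoints from P) := by
  rw [localPoints.smul_def]
  change _ = Affine.Point.map _ _
  cases P <;> rfl

/-- **Restriction from `K` to itself is injective**: the kernel of the local restriction
`H¹(K, W) → H¹(K, W(K̄_K))` at the `K`-field `E := K` is trivial. The kernel is independent of the
`K`-embedding `K̄ → K̄_K` (`localRestrictionKerOfEmb_eq_holds`); for the identity embedding the
compatible pair is the identity of `(Γ_K, W(K̄))`, so a class restricting to a coboundary is a
coboundary. Serre, *Galois Cohomology*, II.§1.1 (the maps `H^q(G_K, A(K_s)) → H^q(G_{K'}, A(K'_s))`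
attached to `K → K'`, here `K' = K`). [cite: SerreGaloisCohomology1997, II.§1.1] -/
theorem localRestrictionKer_self_eq_bot : W.localRestrictionKer K = ⊥ := by
  rw [← localRestrictionKerOfEmb_eq_holds W K (AlgHom.id K (AlgebraicClosure K))]
  refine eq_bot_iff.mpr fun c hc => ?_
  obtain ⟨f, rfl⟩ := oneCocycleClass_surjective _ c
  rw [localRestrictionKerOfEmb, oneCocycleClass_mem_resKer_iff] at hc
  obtain ⟨a, ha⟩ := hc
  rw [AddSubgroup.mem_bot, oneCocycleClass_eq_zero_iff]
  refine ⟨(show W.geomPoints from a), fun σ => ?_⟩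
  have h := ha σ
  rw [resGalOfEmb_id_apply, pointsMapOfEmb_id_apply, smul_localPoints_self] at h
  exact h

end WeierstrassCurve

namespace Literature.NumberTheory.EllipticCurves

namespace MordellDescent

open WeierstrassCurve GaloisRepresentations

variable {K : Type u} [Field K] [CharZero K] {D c : K} (hc : c ≠ 0) (hD : D = -3 * c ^ 2)

/-! ## §2 Descent values have trivial torsor class -/

/-- **`a ∈ δ(E'(K)) K*³ ⟹ [C_a] = 0`** (`δ = phiDescent c : E'(K) = E_{81c²}(K) → K`,
`O ↦ 1`, `−T' ↦ (18c)²`, `(X, Y) ↦ Y + 9c`): the composite `E'(K) → K*/K*³ = H¹(K, E_D[φ]) → H¹(K, E_D)`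
is zero — the easy half of the exactness of Silverman's X.4.2(a) at `H¹(G, E[φ])`, converse of the
tree's `exists_phiDescent_eq_of_torsorClass_eq_zero`. Obtained from the tree's place-by-place
statement `torsorClass_mem_localRestrictionKer` at the `K`-field `K` itself, where the local kernel
is trivial (`localRestrictionKer_self_eq_bot`). [cite: SilvermanAEC2009, Thm. X.4.2(a)] -/
theorem torsorClass_eq_zero_of_phiDescent {a : K} (ha : a ≠ 0)
    (h : ∃ (P : (mordellCurve (81 * c ^ 2)).toAffine.Point) (w : K), w ≠ 0 ∧ phiDescent c P = a * w ^ 3) :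
    torsorClass hc hD ha = 0 := by
  have hmem : torsorClass hc hD ha ∈ (mordellCurve D).localRestrictionKer K :=
    torsorClass_mem_localRestrictionKer (E := K) hc hD ha h
  rwa [localRestrictionKer_self_eq_bot, AddSubgroup.mem_bot] at hmem

include hc in
/-- The `φ`-descent map takes values in `K*`: `δ(P) ≠ 0` (`δ : E'(K)/φ(E(K)) → K*/K*³`, Silverman
X.4.9 / Cassels p. 65). [cite: SilvermanAEC2009, Prop. X.4.9] -/
theorem phiDescent_ne_zero (P : (mordellCurve (81 * c ^ 2)).toAffine.Point) : phiDescent c P ≠ 0 := by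
  rw [phiDescent_eq_cubicDescent]
  exact cubicDescent_ne_zero (mul_ne_zero two_ne_zero (mul_ne_zero (by norm_num) hc)) P

/-- The class of the descent value itself: `[C_{δ(P)}] = 0`. [cite: SilvermanAEC2009, Thm. X.4.2(a)] -/
theorem torsorClass_phiDescent (P : (mordellCurve (81 * c ^ 2)).toAffine.Point) :
    torsorClass hc hD (phiDescent_ne_zero hc P) = 0 :=
  torsorClass_eq_zero_of_phiDescent hc hD _ ⟨P, 1, one_ne_zero, by rw [one_pow, mul_one]⟩

/-- Multiplicative-class form: the class `[δ(P)] ∈ K*/K*³` lies in the kernel of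
`[a] ↦ [C_a]` (`torsorClassQuotHom`). [cite: SilvermanAEC2009, Thm. X.4.2(a)] -/
theorem torsorClassQuotHom_cubeClass_phiDescent (P : (mordellCurve (81 * c ^ 2)).toAffine.Point) :
    torsorClassQuotHom hc hD (cubeClass (phiDescent c P)) = 1 := by
  rw [cubeClass_of_ne_zero (phiDescent_ne_zero hc P), torsorClassQuotHom_mk]
  rw [show torsorClass hc hD (Units.mk0 _ (phiDescent_ne_zero hc P)).ne_zero =
      torsorClass hc hD (phiDescent_ne_zero hc P) from rfl, torsorClass_phiDescent]
  rfl

/-- Hence every class in the subgroup of `K*/K*³` generated by descent values has trivial torsor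
class: if `x ∈ K*/K*³` lies in the closure of `{[δ(P)] : P ∈ E'(K)}` then `[C_x] = 0`.
[cite: SilvermanAEC2009, Thm. X.4.2(a)] -/
theorem torsorClassQuotHom_eq_one_of_mem_closure {x : CubeUnits K}
    (hx : x ∈ Subgroup.closure
      (Set.range fun P : (mordellCurve (81 * c ^ 2)).toAffine.Point => cubeClass (phiDescent c P))) :
    torsorClassQuotHom hc hD x = 1 := by
  rw [← MonoidHom.mem_ker]
  refine (Subgroup.closure_le _).mpr ?_ hx
  rintro _ ⟨P, rfl⟩
  exact (MonoidHom.mem_ker).mpr (torsorClassQuotHom_cubeClass_phiDescent hc hD P)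

/-! ## §3 The image theorem: `ker f_* ⊆ im [C_·]` for an equivariant surjection with kernel in `E_D[φ]` -/

section Image

variable {W' : WeierstrassCurve K} (f : geomPoints (mordellCurve D) →+ geomPoints W')
  (hf : ∀ (σ : Field.absoluteGaloisGroup K) (P : geomPoints (mordellCurve D)), f (σ • P) = σ • f P)

/-- **`f_* [C_a] = 0` when `f(T) = O`**: the torsor cocycle takes values in `ℤ T ⊆ ker f`.
[cite: SilvermanAEC2009, Thm. X.4.2(a)] -/
theorem galH1Map_torsorClass_eq_zero (hfT : f (torsT hc hD) = 0) {a : K} (ha : a ≠ 0) :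
    galH1Map f hf (torsorClass hc hD ha) = 0 := by
  rw [torsorClass, galH1Map_oneCocycleClass, oneCocycleClass_eq_zero_iff]
  refine ⟨0, fun σ => ?_⟩
  rw [contOneCocycles.push_apply, torsorCocycle_apply, torsorFun, chiT_eq_val_nsmul, map_nsmul, hfT,
    nsmul_zero, discreteTopRep_ρ_apply, smul_zero, sub_zero]

/-- The exponent `n ∈ ℤ/3ℤ` of a point of `{O, T, −T}`: `O ↦ 0`, `T ↦ 1`, `−T ↦ −1`. [folklore] -/
private theorem exists_eq_chiT {P : geomPoints (mordellCurve D)}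
    (hP : P = 0 ∨ P = torsT hc hD ∨ P = -torsT hc hD) : ∃ n : ZMod 3, chiT hc hD n = P := by
  rcases hP with h | h | h
  · exact ⟨0, by rw [map_zero, h]⟩
  · exact ⟨1, by rw [chiT_one, h]⟩
  · exact ⟨-1, by rw [map_neg, chiT_one, h]⟩

/-- **`ker f_* ⊆ im [C_·]`** — a class `c ∈ H¹(K, E_D)` killed by `f_*`, for a `Γ_K`-equivariant
surjection `f : E_D(K̄) → W'(K̄)` with `ker f ⊆ {O, ±T} = E_D[φ]`, is a torsor class `[C_a]`
(Silverman, *AEC*, Thm. X.4.2(a): `H¹(G, E[φ]) = K*/K*³` maps onto `WC(E/K)[φ]`; Cassels 1964, p. 65).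
Proof: `f ∘ g = ∂(f P)` makes `g − ∂P` a cocycle `σ ↦ n(σ) T` with `n(στ) = n(σ) + ε(σ) n(τ)`;
Hilbert 90 for the locally constant `K̄*`-valued cocycle `ω^{n(σ)}` gives `β` with `σβ = ω^{n(σ)} β`,
so `β³ = a ∈ K*`, `∛a = ω^j β`, `kummerExp a σ = n(σ) + (ε(σ) − 1) j`, and `[C_a] = [g − ∂P] + [∂(jT)] = c`.
[cite: SilvermanAEC2009, Thm. X.4.2(a)] -/
theorem exists_torsorClass_eq_of_galH1Map_eq_zero (hsurj : Function.Surjective f)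
    (hker : ∀ P : geomPoints (mordellCurve D), f P = 0 → P = 0 ∨ P = torsT hc hD ∨ P = -torsT hc hD)
    (c₀ : (mordellCurve D).galH1) (hc₀ : galH1Map f hf c₀ = 0) :
    ∃ (a : K) (ha : a ≠ 0), torsorClass hc hD ha = c₀ := by
  obtain ⟨g, rfl⟩ := oneCocycleClass_surjective _ c₀
  rw [galH1Map_oneCocycleClass, oneCocycleClass_eq_zero_iff] at hc₀
  obtain ⟨Q, hQ⟩ := hc₀
  obtain ⟨P, rfl⟩ := hsurj Q
  have hQ' : ∀ σ : Field.absoluteGaloisGroup K, f (g.1 σ) = σ • f P - f P := fun σ => hQ σ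
  -- `g' = g - ∂P` takes values in `{O, ±T}`
  set g' := g - cobCocycle P (continuous_smul_geomPoints _ P) with hg'
  have hg'val : ∀ σ : Field.absoluteGaloisGroup K, g'.1 σ = g.1 σ - (σ • P - P) := fun σ => rfl
  have hg'ker : ∀ σ : Field.absoluteGaloisGroup K,
      g'.1 σ = 0 ∨ g'.1 σ = torsT hc hD ∨ g'.1 σ = -torsT hc hD := by
    intro σ
    apply hker
    rw [hg'val, map_sub, map_sub, hf, hQ', sub_self]
  have hclass : oneCocycleClass _ g' = oneCocycleClass _ g := by
    rw [hg', oneCocycleClass_sub, oneCocycleClass_cobCocycle, sub_zero]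
  -- the exponent function `n : Γ_K → ℤ/3ℤ` with `g' σ = n(σ) T`
  choose n hn using fun σ => exists_eq_chiT hc hD (hg'ker σ)
  have hinj := chiT_injective hc hD
  -- the twisted homomorphism identity `n(στ) = n(σ) + ε(σ) n(τ)`
  have hnmul : ∀ σ τ : Field.absoluteGaloisGroup K, n (σ * τ) = n σ + eps σ * n τ := by
    intro σ τ
    apply hinj
    rw [hn, map_add, ← smul_chiT, hn, hn]
    exact g'.2 σ τ
  -- the `μ₃`-valued cocycle `s(σ) = ω^{n(σ)}`
  set s : Field.absoluteGaloisGroup K → AlgebraicClosure K := fun σ => omega K ^ (n σ).val with hs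
  have hs0 : ∀ σ, s σ ≠ 0 := fun σ => pow_ne_zero _ (omega_ne_zero K)
  have hslc : IsLocallyConstant s := by
    have hglc : IsLocallyConstant g'.1 := (IsLocallyConstant.iff_continuous g'.1).mpr g'.1.continuous
    have hns : s = (fun x : geomPoints (mordellCurve D) =>
        omega K ^ (if h : ∃ m : ZMod 3, chiT hc hD m = x then (Classical.choose h).val else 0)) ∘ g'.1 := by
      funext σ
      simp only [Function.comp_apply, hs]
      have hex : ∃ m : ZMod 3, chiT hc hD m = g'.1 σ := ⟨n σ, hn σ⟩
      rw [dif_pos hex]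
      congr 2
      exact (hinj ((Classical.choose_spec hex).trans (hn σ).symm)).symm
    rw [hns]
    exact hglc.comp _
  have hscoc : ∀ σ τ : Field.absoluteGaloisGroup K, s (σ * τ) = s σ * σ • s τ := by
    intro σ τ
    change omega K ^ (n (σ * τ)).val = omega K ^ (n σ).val * galAut σ (omega K ^ (n τ).val)
    rw [galAut_omega_pow, ← pow_add, omega_pow_eq_pow_iff, hnmul]
    push_cast
    rw [ZMod.natCast_zmod_val, ZMod.natCast_zmod_val, ZMod.natCast_zmod_val, epsNat_cast]
  obtain ⟨β, hβ0, hβ⟩ :=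
    absoluteGaloisGroup.exists_eq_smul_div_of_isLocallyConstant_cocycle K hslc hs0 hscoc
  have hσβ : ∀ σ : Field.absoluteGaloisGroup K, galAut σ β = s σ * β := by
    intro σ
    change σ • β = s σ * β
    rw [hβ σ, div_mul_cancel₀ _ hβ0]
  have hs3 : ∀ σ, s σ ^ 3 = 1 := by
    intro σ
    change (omega K ^ (n σ).val) ^ 3 = 1
    rw [← pow_mul, mul_comm, pow_mul, omega_pow_three, one_pow]
  -- `β³ = a ∈ K`
  have hβ3 : ∀ σ : Field.absoluteGaloisGroup K, galAut σ (β ^ 3) = β ^ 3 := by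
    intro σ
    rw [map_pow, hσβ, mul_pow, hs3, one_mul]
  obtain ⟨a, hda⟩ := exists_algebraMap_eq_of_forall_galAut hβ3
  have ha0 : a ≠ 0 := by
    rintro rfl
    rw [map_zero, eq_comm] at hda
    exact pow_ne_zero 3 hβ0 hda
  -- `∛a = ω^j β`
  obtain ⟨j, -, hj⟩ : ∃ j < 3, omega K ^ j = cubeRoot a / β := by
    apply exists_pow_eq_of_pow_three_eq_one K
    rw [div_pow, cubeRoot_pow_three, hda, div_self (pow_ne_zero 3 hβ0)]
  have hroot : cubeRoot a = omega K ^ j * β := by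
    rw [hj, div_mul_cancel₀ _ hβ0]
  -- `kummerExp a σ = n(σ) + (ε(σ) − 1) j`
  have hkum : ∀ σ : Field.absoluteGaloisGroup K, kummerExp a σ = n σ + (eps σ - 1) * j := by
    intro σ
    have h : galAut σ (cubeRoot a) = omega K ^ (epsNat σ * j + (n σ).val + 2 * j) * cubeRoot a := by
      have hω3 := omega_pow_three K
      conv_lhs => rw [hroot, map_mul, galAut_omega_pow, hσβ]
      rw [hroot]
      change omega K ^ (epsNat σ * j) * (omega K ^ (n σ).val * β) =
        omega K ^ (epsNat σ * j + (n σ).val + 2 * j) * (omega K ^ j * β)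
      have : omega K ^ (epsNat σ * j + (n σ).val + 2 * j) * (omega K ^ j * β) =
          omega K ^ (epsNat σ * j) * omega K ^ (n σ).val * (omega K ^ 3) ^ j * β := by ring
      rw [this, hω3, one_pow, mul_one, mul_assoc]
    rw [kummerExp_eq_of_galAut_eq ha0 h]
    push_cast
    rw [epsNat_cast, ZMod.natCast_zmod_val]
    have h3 : (2 : ZMod 3) = -1 := by decide
    rw [h3]
    ring
  -- the torsor cocycle of `a` is `g' + ∂(jT)`
  refine ⟨a, ha0, ?_⟩
  rw [torsorClass, ← hclass, ← sub_eq_zero, ← oneCocycleClass_sub, oneCocycleClass_eq_zero_iff]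
  refine ⟨chiT hc hD (j : ZMod 3), fun σ => ?_⟩
  change torsorFun hc hD a σ - g'.1 σ = σ • chiT hc hD (j : ZMod 3) - chiT hc hD (j : ZMod 3)
  rw [torsorFun, hkum, map_add, hn, chiT_eps_sub_one_mul, add_sub_cancel_left]

/-- **`ker f_* = im [C_·]`, elementwise**: under the hypotheses of the image theorem and `f(T) = O`,
a class of `H¹(K, E_D)` is killed by `f_*` iff it is a torsor class. [cite: SilvermanAEC2009, Thm. X.4.2(a)] -/
theorem galH1Map_eq_zero_iff_exists_torsorClass (hsurj : Function.Surjective f)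
    (hker : ∀ P : geomPoints (mordellCurve D), f P = 0 → P = 0 ∨ P = torsT hc hD ∨ P = -torsT hc hD)
    (hfT : f (torsT hc hD) = 0) (c₀ : (mordellCurve D).galH1) :
    galH1Map f hf c₀ = 0 ↔ ∃ (a : K) (ha : a ≠ 0), torsorClass hc hD ha = c₀ := by
  constructor
  · exact exists_torsorClass_eq_of_galH1Map_eq_zero hc hD f hf hsurj hker c₀
  · rintro ⟨a, ha, rfl⟩
    exact galH1Map_torsorClass_eq_zero hc hD f hf hfT ha

/-- **Sharp descent kills `Ш ∩ ker f_*`.** Over a number field: if every `a ∈ K*` whose torsor class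
lies in `Ш(E_D/K)` has its class `[a] ∈ K*/K*³` in the subgroup generated by the descent values
`[δ(P)]`, `P ∈ E'(K)` — i.e. the `f`-Selmer group is filled by rational points — then no non-zero
class of `Ш(E_D/K)` is killed by `f_*`: `Ш(E_D/K) ∩ ker f_* = 0`, the tree's form of
`Ш(E_D/K)[φ] = 0` (resp. `Ш[√−3] = 0`). [cite: SilvermanAEC2009, Thm. X.4.2(a)] -/
theorem eq_zero_of_mem_sha_of_galH1Map_eq_zero [NumberField K] (hsurj : Function.Surjective f)
    (hker : ∀ P : geomPoints (mordellCurve D), f P = 0 → P = 0 ∨ P = torsT hc hD ∨ P = -torsT hc hD)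
    (hsharp : ∀ (a : K) (ha : a ≠ 0), torsorClass hc hD ha ∈ (mordellCurve D).sha →
      cubeClass a ∈ Subgroup.closure
        (Set.range fun P : (mordellCurve (81 * c ^ 2)).toAffine.Point => cubeClass (phiDescent c P)))
    {c₀ : (mordellCurve D).galH1} (hsha : c₀ ∈ (mordellCurve D).sha) (h0 : galH1Map f hf c₀ = 0) :
    c₀ = 0 := by
  obtain ⟨a, ha, rfl⟩ := exists_torsorClass_eq_of_galH1Map_eq_zero hc hD f hf hsurj hker c₀ h0
  have h1 := torsorClassQuotHom_eq_one_of_mem_closure hc hD (hsharp a ha hsha)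
  rw [cubeClass_of_ne_zero ha, torsorClassQuotHom_mk] at h1
  have h2 : torsorClass hc hD (Units.mk0 a ha).ne_zero = 0 := Multiplicative.ofAdd.injective h1
  exact h2

end Image

end MordellDescent

end Literature.NumberTheory.EllipticCurves
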